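import Summits.CriticalPhenomena.PercolationContinuityZ3.Theorems.Transplant.Z3TallGensExamples
import Summits.CriticalPhenomena.PercolationContinuityZ3.Theorems.Transplant.CdsNetCritical
import HarnessLib

/-!
# Class C1b after gen 11 — the new rows in ONE conjunction: the tall Cayley graphs of `ℤ³` with an axis flip, the slanted and axial families, the
# `cds` net (all UNCONDITIONAL), and the whole tall family conditional on the `{±1}` node

builds on p205010 (kernel theorem, internal audit signed; external expert review pending) — every unconditional conjunct runs through the D″ single-type node
`samePDropOfSkeletonSign₁_holds` (audited, V110); the last conjunct takes the OPEN node `SamePDropOfSkeletonNeg₁` as a hypothesis.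
Lane `prim-bschramm`, seat `prim-bschramm-p2` (gen 11; class C1b "other 3D lattices / slabs / half-spaces at their own critical points", METHOD = input
substitution); helper file (`--supports stmt-CriticalPhenomena-4575 --as helper`); PROOFS ONLY (pattern `sign₁Customers_holds`, p1-g10).  Memo: `HOME/bschramm/P2-LATTICES.md`
§32–§34 (table v20).  One citable statement for digests and audits (`#print axioms c1bGen11_catalogue` = the standard three).
[cite: BenjaminiSchramm1996, Conj. 4] [cite: GrimmettPercolation1999, §12.1 p. 349 (general lattices)] [cite: OKeeffeHyde1996, §7.5.1 pp. 292–293 (the CdSO₄ net)]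
-/

noncomputable section

namespace Summit.CriticalPhenomena.PercolationContinuityZ3.Theorems.Transplant

open MeasureTheory Literature.Probability.Percolation Literature.Probability.LatticeModels SimpleGraph

/-- **CLASS C1b, GEN 11, IN ONE CONJUNCTION.**  Unconditionally (kernel theorems through the audited D″ node): `θ(v, p_c) = 0` at every vertex of
(1) `Cay(ℤ³; ±e₀, ±e₁, ±e₂, ±(e₀ + m e₂))` for every slope `m ∈ ℤ`; (2) `Cay(ℤ³; ±eᵢ, ±(n+2)e₂)` for every `n` (axial next-nearest neighbours); (3)–(5) every tall
Cayley graph `Cay(ℤ³; S)` (`S ⊆ {−1,0,1}² × ℤ` finite symmetric containing the axes) preserved by `flipY = (x₀,−x₁,x₂)`, by `flipYZ = (x₀,−x₁,−x₂)` or by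
`flipX = (−x₀,x₁,−x₂)`; (6) the `cds` (CdSO₄) net; and (7) conditionally on the single-type `{±1}` node, every tall `Cay(ℤ³; S)` whatsoever.
[cite: BenjaminiSchramm1996, Conj. 4] [cite: OKeeffeHyde1996, §7.5.1] -/
theorem c1bGen11_catalogue :
    (∀ (m : ℤ) (v : Site 3), theta (Slant.graph m) v (criticalProbIOf (Slant.graph m) v) = 0) ∧
    (∀ (n : ℕ) (v : Site 3), theta (Axial.graph n) v (criticalProbIOf (Axial.graph n) v) = 0) ∧
    (∀ T : TallGens, (∀ s ∈ T.S, Z3Diag.flipY s ∈ T.S) → ∀ v : Site 3, theta T.graph v (criticalProbIOf T.graph v) = 0) ∧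
    (∀ T : TallGens, (∀ s ∈ T.S, UnitGens.flipYZ s ∈ T.S) → ∀ v : Site 3, theta T.graph v (criticalProbIOf T.graph v) = 0) ∧
    (∀ T : TallGens, (∀ s ∈ T.S, Z3Diag.flipX s ∈ T.S) → ∀ v : Site 3, theta T.graph v (criticalProbIOf T.graph v) = 0) ∧
    (∀ v : Site 3, theta Cds.graph v (criticalProbIOf Cds.graph v) = 0) ∧
    (SamePDropOfSkeletonNeg₁ → ∀ (T : TallGens) (v : Site 3), theta T.graph v (criticalProbIOf T.graph v) = 0) :=
  ⟨Slant.criticalContinuity, Axial.criticalContinuity, fun T hS v => T.criticalContinuity_of_flipY hS v,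
    fun T hS v => T.criticalContinuity_of_flipYZ hS v, fun T hS v => T.criticalContinuity_of_flipX hS v, Cds.criticalContinuity,
    fun hD T v => T.criticalContinuity_of_negNode₁' hD v⟩

/-- **Scope of the catalogue**: every graph in it is connected and vertex-transitive with `p_c < 1` (instances of Benjamini–Schramm's Conjecture 4).
[cite: BenjaminiSchramm1996, Conj. 4 and §2] -/
theorem c1bGen11_scope :
    (∀ T : TallGens, T.graph.Connected ∧ Literature.Barriers.CriticalPhenomena.IsGraphTransitive T.graph ∧ criticalProb T.graph (0 : Site 3) < 1) ∧
    (Cds.graph.Connected ∧ Literature.Barriers.CriticalPhenomena.IsGraphTransitive Cds.graph ∧ criticalProb Cds.graph (0 : Site 3) < 1) :=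
  ⟨fun T => ⟨T.graph_connected, T.graph_transitive, T.criticalProb_lt_one⟩, Cds.graph_connected, Cds.graph_transitive, Cds.criticalProb_lt_one⟩

end Summit.CriticalPhenomena.PercolationContinuityZ3.Theorems.Transplant

end
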